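import Literature.Analysis.FluidPDE.FluidComputer.LocalCircuitShadowing
import HarnessLib

/-!
# Fluid computer blueprint — the REACH layer: a certified reach–avoid tube replaces shadowing

HONEST FRAMING: low prior, high value-of-information experiment on Tao's machine paradigm; NOT a
claim that NS blows up. Nothing in this file constructs a design; every theorem is an implication
from a structure that, as far as anyone knows, is uninhabited for the true equations.

`LocalCircuit.lean` / `LocalCircuitShadowing.lean` typed Tao's machine (J. Amer. Math. Soc. 29
(2016), §1.3) as a circuit design with LOCAL, GUARDED dynamics: a Lipschitz vector field `F` on an
open working region `U` with its flow `Φ`, two instantaneous guarded inequalities about the true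
flow (`defect`: the readout's rescaled velocity is `ε`-close to `F`; `junk_rate`), and a DEFECT
BUDGET `gronwallBound 0 L ε τc ≤ δsh`, i.e. `ε ≤ δsh · L / (e^{L τc} - 1)` — exponentially small in
the rate–delay product `L τc` of the design (`LocalCircuit.defect_budget_exp`). That budget is the
price of SHADOWING: of asking the true readout to stay `δsh`-close to the circuit's OWN orbit,
pointwise in time, for the whole tick. The cascade never uses pointwise closeness. Its realisation
axiom `fires` needs exactly two things of the readout during a tick: (i) it stays in the working
region `U` (so that the guarded estimates keep applying), and (ii) it REACHES the output region
`Aout` at SOME rescaled time `≤ τc` with junk `≤ jrun √E_n` — early firing is harmless, `handoff`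
does not ask when. (i)+(ii) is a ROBUST REACH–AVOID property of the finite-dimensional differential
inclusion `x' ∈ F(x) + B̄(0, ε)` on `U`: a statement about the DESIGN alone, certifiable without
Grönwall (barrier / Lyapunov-type certificates, validated reachability), whose admissible `ε` is a
MARGIN of the certificate — for a barrier certificate, linear in the design's data
(`BarrierCertificate.lean`) — rather than `e^{-L τc}`.

## The structure `ReachCircuit S O s`

READOUT / REGIONS / STATICS / CLOCK / SEED / LEAK BUDGET and the two guarded DYNAMICS fields
`defect`, `junk_rate` are VERBATIM those of `LocalCircuit`. The CIRCUIT group is now: the design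
vector field `F` (no Lipschitz constant is asked for), the open working region `U`, the defect
level `ε`, a time-dependent REACH TUBE `Tube p σ ⊆ U` (`p ∈ Ain`, `σ ∈ [0, τc]`) with closed graph
over `[0, τc]` and `p ∈ Tube p 0`, and ONE certificate field `cert`: every continuous curve
`x : [0, σT] → O`, `σT ≤ τc`, with `x 0 = p ∈ Ain`, staying in `U` on `[0, σT)` and having there a
right derivative `ε`-close to `F`, ends in `Tube p σT`; and if `σT = τc` it has visited `Aout` at
some time in `[0, τc]`. (The hypothesis on `x` is the shape of Mathlib's approximate trajectories,
`dist_le_of_approx_trajectories_ODE_of_mem`, and of `Tao2016AveragedNS/CircuitShadowing.lean`'s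
`IsPseudoOrbit`.)

## What is DERIVED (soft, unconditional given the structure)

* `ReachCircuit.cert_of_guard` — while the state is in the working region, the rescaled readout of
  a mild Navier–Stokes trajectory IS such a curve (`defect`), so the certificate applies to it;
* `ReachCircuit.reach_sharp` — THE BOOTSTRAP (continuous induction over one tick): loaded at
  generation `n` at time `t` ⇒ for every rescaled `σ ≤ τc` inside the lifespan the readout is in
  `Tube (read n (u t)) σ` AND the junk is `≤ (jin + γ σ) √E_n`. The set of physical times where
  both hold is closed (`Tube_closed`; readout and junk are continuous along the trajectory),
  contains `t` (`Tube_zero`), and propagates: both conditions put the state in the working region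
  (`Tube_sub`; `jin + γ τc ≤ jrun < jbar`), which is OPEN, so the state stays in it a little
  longer, and there `cert_of_guard` and the Dini fence `junk_toReal_le_of_guard` re-prove both;
* `ReachCircuit.fires` (the certificate's reach clause + `leak` + `handoff`), `toPumpCascade`,
  `toRobustPumpCascade` (explicit tolerance `ρ = min (δ/Λ) (jin - jcore)`), `live` given the mild
  theory and `H10Control` (now: `H¹⁰` control of the reach tube), hence no loaded state is doomed
  and — downstream, summit side — finite lifespan `≤ T_*` for `α > 0`, `η > 1/4`;
* `LocalCircuit.toReachCircuit` — the local layer IS a reach design: `Tube p σ` = the closed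
  `gronwallBound 0 L ε σ`-ball about `Φ σ p`, `cert` = Grönwall's inequality for approximate
  trajectories + `dat`. So nothing is lost, and the exponential budget is identified as the cost
  of ONE PARTICULAR certificate.

## Honest ceiling

(1) As an abstract type the structure is neither harder nor easier to inhabit than `LocalCircuit`:
the burden is the same two scalar, local, guarded inequalities `defect` / `junk_rate` about the
true flow near a finite-dimensional design, plus finite-dimensional certificates; what changed is
WHICH certificate, hence how large a defect `ε` a given design tolerates. (2) For Tao's own
five-mode gate the reach formulation buys NO larger `ε`: `Tao2016AveragedNS/GateFragility.lean`
(`not_firesOnBudget_of_seed_mul_le`) shows that ANY firing notion fails once the forcing budget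
exceeds the seed transfer `ε² e^{-K¹⁰} · T` — there the exponential is the price of ARMING an
exponential instability with a tiny seed (a delayed bifurcation), intrinsic to that gate and not an
artefact of Grönwall bookkeeping. A gate whose delayed abrupt transition is of relaxation (fold)
type would carry a polynomial margin; whether an energy-conserving quadratic circuit admits one is
a finite-dimensional DESIGN question that this file isolates and does not answer. [cite: Tao2016AveragedNS, §1.3 pp. 10–11]
-/

noncomputable section

open MeasureTheory Set Filter Topology
open scoped ENNReal NNReal SchwartzMap

namespace Literature.Analysis.FluidPDE.FluidComputer

open Literature.Analysis.FluidPDE.Tao2016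
open Literature.Analysis.FunctionSpaces (eFourierSobolevNorm)

/-! ### §1. The structure: a circuit design with a certified reach–avoid tube -/

/-- **A circuit design with a CERTIFIED REACH–AVOID TUBE** for Tao's machine over the spec sheet
`S`, with finite-dimensional observable space `O` (a real normed space) and junk measured in `X^s`,
`s ≤ 10`. READOUT / REGIONS / STATICS / CLOCK / SEED / LEAK BUDGET and the guarded DYNAMICS fields
`defect`, `junk_rate` are those of `LocalCircuit`; the CIRCUIT group is the design vector field `F`,
the open working region `U`, the defect level `ε`, a reach tube `Tube p σ ⊆ U` with closed graph
over `[0, τc]` and `p ∈ Tube p 0`, and the certificate `cert`: every `ε`-approximate trajectory of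
`F` from `p ∈ Ain` that stays in `U` on `[0, σT)`, `σT ≤ τc`, ends in `Tube p σT`, and if
`σT = τc` it has visited `Aout`. No flow, no Lipschitz constant, no tube radius, no Grönwall budget.
Nothing asserts such a design exists. [cite: Tao2016AveragedNS, §1.3 pp. 10–11] -/
structure ReachCircuit (S : CascadeSpecs) (O : Type*) [NormedAddCommGroup O] [NormedSpace ℝ O]
    (s : ℝ) where
  /-- READOUT: the generation-`n` observable of a state (rescaled units) -/
  read : ℕ → L2C → O
  /-- the clean design state of generation `n` with a given readout -/
  recon : ℕ → O → L2C
  /-- the size of the non-design ("junk") part of a state at generation `n` -/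
  junk : ℕ → L2C → ℝ≥0∞
  /-- Lipschitz modulus of the readouts -/
  Λ : ℝ
  Λ_pos : 0 < Λ
  /-- the readout of generation `n` is `Λ`-Lipschitz from `L²` measured in units of `√E_n` -/
  read_lip : ∀ (n : ℕ) (v w : L2C), dist (read n v) (read n w) * Real.sqrt (S.Emin n) ≤ Λ * ‖v - w‖
  /-- the junk functional of generation `n` is `1`-Lipschitz in `X^s` at scale `λ_n` -/
  junk_perturb : ∀ (n : ℕ) (v w : L2C), junk n w ≤ junk n v + scaledSobolevNorm s (S.lam n) (w - v)
  /-- the junk order is at most the regularity of the mild theory -/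
  s_le_ten : s ≤ 10
  /-- design states read as designed -/
  read_recon : ∀ (n : ℕ) (p : O), read n (recon n p) = p
  /-- design states carry no junk -/
  junk_recon : ∀ (n : ℕ) (p : O), junk n (recon n p) = 0
  /-- REGIONS: admissible input readouts -/
  Ain : Set O
  /-- loaded-core readouts (where a fresh generation starts) -/
  Acore : Set O
  /-- output readouts (where a generation hands off) -/
  Aout : Set O
  /-- thickness of the core inside the input region -/
  δ : ℝ
  δ_pos : 0 < δ
  core_thick : ∀ p ∈ Acore, Metric.ball p δ ⊆ Ain
  /-- junk thresholds (relative, in units of `√E_n`): core-loaded, loaded, running, and the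
  junk CEILING of the working region -/
  jcore : ℝ
  jin : ℝ
  jrun : ℝ
  jbar : ℝ
  jcore_nonneg : 0 ≤ jcore
  jcore_lt : jcore < jin
  jrun_lt_jbar : jrun < jbar
  /-- STATICS (self-reproduction with erasure): read in `Aout` at generation `n` with running junk
  ⇒ read in `Acore` at generation `n+1` with core junk -/
  handoff : ∀ (n : ℕ) (v : L2C), read n v ∈ Aout →
    junk n v ≤ ENNReal.ofReal (jrun * Real.sqrt (S.Emin n)) →
      read (n + 1) v ∈ Acore ∧ junk (n + 1) v ≤ ENNReal.ofReal (jcore * Real.sqrt (S.Emin (n + 1)))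
  /-- STATICS: loaded states of generation `n` carry energy `≥ E_n` at frequencies `|ξ| ≥ λ_n` -/
  floor_cert : ∀ (n : ℕ) (v : L2C), read n v ∈ Ain →
    junk n v ≤ ENNReal.ofReal (jin * Real.sqrt (S.Emin n)) →
      ENNReal.ofReal (S.Emin n) ≤ highFreqEnergy (S.lam n) v
  /-- CIRCUIT: the design vector field on `O` (rescaled time) -/
  F : O → O
  /-- the open WORKING REGION of readouts on which the local estimates are claimed -/
  U : Set O
  U_open : IsOpen U
  /-- rescaled cycle time -/
  τc : ℝ
  τc_nonneg : 0 ≤ τc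
  /-- admissible readout-velocity defect per unit rescaled time -/
  ε : ℝ
  ε_nonneg : 0 ≤ ε
  /-- REACH TUBE: the readouts certified reachable at rescaled time `σ` from the input readout `p`
  by `ε`-approximate trajectories of `F` inside `U` -/
  Tube : O → ℝ → Set O
  /-- the tube from an admissible input has closed graph over `[0, τc]` -/
  Tube_closed : ∀ p ∈ Ain, IsClosed {z : ℝ × O | z.1 ∈ Icc 0 τc ∧ z.2 ∈ Tube p z.1}
  /-- it starts at the input readout -/
  Tube_zero : ∀ p ∈ Ain, p ∈ Tube p 0
  /-- AVOID: it lies in the working region for the whole cycle -/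
  Tube_sub : ∀ p ∈ Ain, ∀ σ ∈ Icc 0 τc, Tube p σ ⊆ U
  /-- CERTIFICATE (robust reach–avoid, finite-dimensional): every continuous curve on `[0, σT]`,
  `σT ≤ τc`, from `p ∈ Ain`, in `U` on `[0, σT)` with right derivative `ε`-close to `F` there, ends
  in `Tube p σT`; and if `σT = τc` it has visited `Aout` (REACH) -/
  cert : ∀ p ∈ Ain, ∀ (σT : ℝ) (x : ℝ → O), 0 ≤ σT → σT ≤ τc → x 0 = p →
    ContinuousOn x (Icc 0 σT) → (∀ σ ∈ Ico 0 σT, x σ ∈ U) →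
      (∀ σ ∈ Ico 0 σT, ∃ W : O, HasDerivWithinAt x W (Ici σ) σ ∧ ‖W - F (x σ)‖ ≤ ε) →
        x σT ∈ Tube p σT ∧ (σT = τc → ∃ σ ∈ Icc 0 τc, x σ ∈ Aout)
  /-- LEAK BUDGET: junk growth rate (relative units per unit rescaled time) -/
  γ : ℝ
  γ_nonneg : 0 ≤ γ
  /-- loaded junk plus one cycle of leakage is running junk -/
  jrun_ge : jin + γ * τc ≤ jrun
  /-- CLOCK: physical time per unit rescaled time at generation `n` -/
  unit : ℕ → ℝ
  unit_pos : ∀ n, 0 < unit n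
  /-- one cycle fits in the spec's firing allowance -/
  clock : ∀ n, unit n * τc ≤ S.Tmax n
  /-- DYNAMICS (idea-bound, local, guarded): READOUT DEFECT — along every `H¹⁰_df`-mild
  Navier–Stokes trajectory, at every instant at which the state is in the generation-`n` working
  region, the readout has a right derivative whose rescaled value is `ε`-close to the design
  vector field -/
  defect : ∀ (n : ℕ) (a : L2C) (S' : ℝ) (u : ℝ → L2C), IsMildSolutionFor eulerForm a (Ico 0 S') u →
    ∀ t : ℝ, 0 ≤ t → t < S' → read n (u t) ∈ U →
      junk n (u t) < ENNReal.ofReal (jbar * Real.sqrt (S.Emin n)) →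
        ∃ W : O, HasDerivWithinAt (fun t' => read n (u t')) W (Ici t) t ∧
          ‖unit n • W - F (read n (u t))‖ ≤ ε
  /-- DYNAMICS (idea-bound, local, guarded): JUNK RATE — meanwhile the lower right Dini derivative
  of the generation-`n` junk is at most `γ √E_n / unit n` -/
  junk_rate : ∀ (n : ℕ) (a : L2C) (S' : ℝ) (u : ℝ → L2C),
    IsMildSolutionFor eulerForm a (Ico 0 S') u →
      ∀ t : ℝ, 0 ≤ t → t < S' → read n (u t) ∈ U →
        junk n (u t) < ENNReal.ofReal (jbar * Real.sqrt (S.Emin n)) →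
          ∀ ρ : ℝ, γ < ρ → ∃ᶠ t' in 𝓝[>] t,
            junk n (u t') ≤ junk n (u t) + ENNReal.ofReal (ρ * Real.sqrt (S.Emin n) * ((t' - t) / unit n))
  /-- SEED: the ignition datum -/
  u₀ : 𝓢(EuclideanSpace ℝ (Fin 3), EuclideanSpace ℝ (Fin 3))
  divFree : VectorCalculus.IsDivFree ⇑u₀
  memH10df : MemH10df (schwartzL2 u₀)
  /-- it is read in the loaded core at generation `0` … -/
  seed_read : read 0 (schwartzL2 u₀) ∈ Acore
  /-- … with core junk -/
  seed_junk : junk 0 (schwartzL2 u₀) ≤ ENNReal.ofReal (jcore * Real.sqrt (S.Emin 0))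

namespace ReachCircuit

variable {S : CascadeSpecs} {O : Type*} [NormedAddCommGroup O] [NormedSpace ℝ O] {s : ℝ}
  (R : ReachCircuit S O s)

/-! ### §2. The working region, the thresholds, the input and output classes -/

/-- The generation-`n` **working region** guard of a state: readout in the open region `U`, junk
strictly below the ceiling `jbar √E_n`. [folklore] -/
def Guard (n : ℕ) (v : L2C) : Prop :=
  R.read n v ∈ R.U ∧ R.junk n v < ENNReal.ofReal (R.jbar * Real.sqrt (S.Emin n))

/-- `jin ≤ jrun` (the leak over a cycle is nonnegative). [folklore] -/
theorem jin_le_jrun : R.jin ≤ R.jrun :=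
  (le_add_of_nonneg_right (mul_nonneg R.γ_nonneg R.τc_nonneg)).trans R.jrun_ge

/-- `0 < jbar` (`0 ≤ jcore < jin ≤ jrun < jbar`). [folklore] -/
theorem jbar_pos : 0 < R.jbar :=
  ((R.jcore_nonneg.trans_lt R.jcore_lt).trans_le R.jin_le_jrun).trans R.jrun_lt_jbar

/-- Loaded junk plus leakage for rescaled time `σ ≤ τc` is at most running junk. [folklore] -/
theorem jin_add_mul_le {σ : ℝ} (hσ : σ ≤ R.τc) : R.jin + R.γ * σ ≤ R.jrun :=
  (add_le_add_right (mul_le_mul_of_nonneg_left hσ R.γ_nonneg) _).trans R.jrun_ge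

/-- **A state read in the reach tube at a rescaled time `σ ≤ τc`, with junk `≤ (jin + γ σ) √E_n`, is
in the working region** (`Tube_sub`; `jin + γ σ ≤ jrun < jbar`). [folklore] -/
theorem guard_of_mem (n : ℕ) {p : O} (hp : p ∈ R.Ain) {σ : ℝ} (hσ : σ ∈ Icc 0 R.τc) {v : L2C}
    (hr : R.read n v ∈ R.Tube p σ)
    (hj : R.junk n v ≤ ENNReal.ofReal ((R.jin + R.γ * σ) * Real.sqrt (S.Emin n))) : R.Guard n v := by
  have hE : 0 < Real.sqrt (S.Emin n) := Real.sqrt_pos.2 (S.Emin_pos n)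
  refine ⟨R.Tube_sub p hp σ hσ hr, hj.trans_lt ?_⟩
  rw [ENNReal.ofReal_lt_ofReal_iff (mul_pos R.jbar_pos hE)]
  exact mul_lt_mul_of_pos_right ((R.jin_add_mul_le hσ.2).trans_lt R.jrun_lt_jbar) hE

/-- The readout of generation `n` is `(Λ/√E_n)`-Lipschitz from `L²`. [folklore] -/
theorem dist_read_le (n : ℕ) (v w : L2C) :
    dist (R.read n v) (R.read n w) ≤ R.Λ / Real.sqrt (S.Emin n) * ‖v - w‖ := by
  have hE : 0 < Real.sqrt (S.Emin n) := Real.sqrt_pos.2 (S.Emin_pos n)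
  rw [div_mul_eq_mul_div, le_div_iff₀ hE]
  exact R.read_lip n v w

/-- The readout of generation `n` is continuous on `L²`. [folklore] -/
theorem read_continuous (n : ℕ) : Continuous (R.read n) := by
  refine (LipschitzWith.of_dist_le' (K := R.Λ / Real.sqrt (S.Emin n)) fun v w => ?_).continuous
  rw [dist_eq_norm v w]
  exact R.dist_read_le n v w

/-- Junk is `H¹⁰`-Lipschitz with the junk modulus: `junk n w ≤ junk n v + C_n ‖w - v‖_{H¹⁰}`
(`junk_perturb`, `s ≤ 10`). [folklore] -/
theorem junk_le_junk_add (n : ℕ) (v w : L2C) :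
    R.junk n w ≤ R.junk n v + S.junkModulus n * eFourierSobolevNorm 10 (w - v) :=
  calc R.junk n w ≤ R.junk n v + scaledSobolevNorm s (S.lam n) (w - v) := R.junk_perturb n v w
    _ ≤ R.junk n v + scaledSobolevNorm 10 (S.lam n) (w - v) :=
        add_le_add_right (scaledSobolevNorm_mono_order R.s_le_ten _ _) _
    _ ≤ R.junk n v + S.junkModulus n * eFourierSobolevNorm 10 (w - v) :=
        add_le_add_right (scaledSobolevNorm_le_mul_eFourierSobolevNorm (by norm_num) (S.lam_pos n) _) _

/-- The generation-`n` **input class** of the design: read in `Ain`, junk at most `jin √E_n`. [cite: Tao2016AveragedNS, §1.3 pp. 10–11] -/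
def In (n : ℕ) : Set L2C :=
  {v | R.read n v ∈ R.Ain ∧ R.junk n v ≤ ENNReal.ofReal (R.jin * Real.sqrt (S.Emin n))}

/-- The generation-`n` **output class** of the design: read in the loaded core at generation `n+1`
with core junk there. [cite: Tao2016AveragedNS, §1.3 pp. 10–11] -/
def Out (n : ℕ) : Set L2C :=
  {v | R.read (n + 1) v ∈ R.Acore ∧
    R.junk (n + 1) v ≤ ENNReal.ofReal (R.jcore * Real.sqrt (S.Emin (n + 1)))}

/-- The loaded core lies in the input region. [folklore] -/
theorem Acore_subset_Ain : R.Acore ⊆ R.Ain :=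
  fun p hp => R.core_thick p hp (Metric.mem_ball_self R.δ_pos)

/-- Core junk is loaded junk: `jcore √E ≤ jin √E`. [folklore] -/
theorem ofReal_jcore_le (n : ℕ) :
    ENNReal.ofReal (R.jcore * Real.sqrt (S.Emin n)) ≤ ENNReal.ofReal (R.jin * Real.sqrt (S.Emin n)) :=
  ENNReal.ofReal_le_ofReal (mul_le_mul_of_nonneg_right R.jcore_lt.le (Real.sqrt_nonneg _))

/-- A state read in the core at generation `n` with core junk is a generation-`n` input state. [folklore] -/
theorem mem_In_of_core {n : ℕ} {v : L2C} (hr : R.read n v ∈ R.Acore)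
    (hj : R.junk n v ≤ ENNReal.ofReal (R.jcore * Real.sqrt (S.Emin n))) : v ∈ R.In n :=
  ⟨R.Acore_subset_Ain hr, hj.trans (R.ofReal_jcore_le n)⟩

/-- **SELF-REPLICATION is a theorem of the design**: `Out n ⊆ In (n+1)`. [cite: Tao2016AveragedNS, §1.3 pp. 10–11] -/
theorem Out_subset_In (n : ℕ) : R.Out n ⊆ R.In (n + 1) :=
  fun _ hv => R.mem_In_of_core hv.1 hv.2

/-- The seed is a generation-`0` input state. [folklore] -/
theorem seed_mem_In : schwartzL2 R.u₀ ∈ R.In 0 :=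
  R.mem_In_of_core R.seed_read R.seed_junk

/-- Non-degeneracy: the clean design state with an admissible readout is an input state. [folklore] -/
theorem recon_mem_In (n : ℕ) {p : O} (hp : p ∈ R.Ain) : R.recon n p ∈ R.In n := by
  refine ⟨?_, ?_⟩
  · rw [R.read_recon]; exact hp
  · rw [R.junk_recon]; exact zero_le

/-- Non-degeneracy: the clean generation-`(n+1)` design state with a core readout is a
generation-`n` output state. [folklore] -/
theorem recon_mem_Out (n : ℕ) {p : O} (hp : p ∈ R.Acore) : R.recon (n + 1) p ∈ R.Out n := by
  refine ⟨?_, ?_⟩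
  · rw [R.read_recon]; exact hp
  · rw [R.junk_recon]; exact zero_le

/-- Every input class is inhabited. [folklore] -/
theorem In_nonempty (n : ℕ) : (R.In n).Nonempty :=
  ⟨R.recon n (R.read 0 (schwartzL2 R.u₀)), R.recon_mem_In n (R.Acore_subset_Ain R.seed_read)⟩

/-- Loaded input readouts are in the working region at rescaled time `0` (`Tube_zero ⊆ U`). [folklore] -/
theorem Ain_subset_U : R.Ain ⊆ R.U :=
  fun p hp => R.Tube_sub p hp 0 ⟨le_rfl, R.τc_nonneg⟩ (R.Tube_zero p hp)

/-! ### §3. Readout and junk ALONG a mild trajectory: finiteness and continuity -/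

section Trajectory

variable {a : L2C} {S' : ℝ} {u : ℝ → L2C} (hu : IsMildSolutionFor eulerForm a (Ico 0 S') u)
include hu

/-- Junk finite at one instant of a mild trajectory is finite at every instant. [folklore] -/
theorem junk_ne_top (n : ℕ) {t : ℝ} (ht : t ∈ Ico 0 S') (hfin : R.junk n (u t) ≠ ⊤) {x : ℝ}
    (hx : x ∈ Ico 0 S') : R.junk n (u x) ≠ ⊤ :=
  ne_top_of_le_ne_top (ENNReal.add_ne_top.2 ⟨hfin, ENNReal.mul_ne_top (S.junkModulus_ne_top n)
    (LocalCircuit.eFourierSobolevNorm_sub_lt_top hu hx ht).ne⟩) (R.junk_le_junk_add n (u t) (u x))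

/-- Junk is continuous along a mild trajectory (where finite). [folklore] -/
theorem junk_tendsto (n : ℕ) {x : ℝ} (hx : x ∈ Ico 0 S') (hfin : R.junk n (u x) ≠ ⊤) :
    Tendsto (fun y => R.junk n (u y)) (𝓝[Ico 0 S'] x) (𝓝 (R.junk n (u x))) := by
  have hQ : Tendsto (fun y => S.junkModulus n * eFourierSobolevNorm 10 (u y - u x))
      (𝓝[Ico 0 S'] x) (𝓝 0) := by
    have h := ENNReal.Tendsto.const_mul (hu.2.1 x hx) (Or.inr (S.junkModulus_ne_top n))
    rwa [mul_zero] at h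
  rw [ENNReal.tendsto_nhds hfin]
  intro e he
  filter_upwards [(tendsto_order.1 hQ).2 e he] with y hy
  refine ⟨tsub_le_iff_right.2 ?_, ?_⟩
  · calc R.junk n (u x) ≤ R.junk n (u y) + S.junkModulus n * eFourierSobolevNorm 10 (u x - u y) :=
          R.junk_le_junk_add n (u y) (u x)
      _ = R.junk n (u y) + S.junkModulus n * eFourierSobolevNorm 10 (u y - u x) := by
          rw [eFourierSobolevNorm_sub_comm]
      _ ≤ R.junk n (u y) + e := add_le_add_right hy.le _
  · calc R.junk n (u y) ≤ R.junk n (u x) + S.junkModulus n * eFourierSobolevNorm 10 (u y - u x) :=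
          R.junk_le_junk_add n (u x) (u y)
      _ ≤ R.junk n (u x) + e := add_le_add_right hy.le _

/-- The real-valued junk is continuous along a mild trajectory (where finite). [folklore] -/
theorem junk_toReal_continuousWithinAt (n : ℕ) {x : ℝ} (hx : x ∈ Ico 0 S')
    (hfin : R.junk n (u x) ≠ ⊤) :
    ContinuousWithinAt (fun y => (R.junk n (u y)).toReal) (Ico 0 S') x :=
  (ENNReal.tendsto_toReal hfin).comp (R.junk_tendsto hu n hx hfin)

/-- The readout is continuous along a mild trajectory. [folklore] -/
theorem read_continuousOn (n : ℕ) : ContinuousOn (fun y => R.read n (u y)) (Ico 0 S') :=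
  (R.read_continuous n).comp_continuousOn hu.2.1.continuousOn

/-! ### §4. The two GUARDED estimates: the certificate applies, and the Dini fence -/

/-- **THE CERTIFICATE APPLIES TO THE TRUE READOUT (guarded).** Along a mild trajectory read in
`Ain` at time `t ≥ 0`, if the state stays in the generation-`n` working region for physical times
`[t, t + unit n · σT)`, `0 ≤ σT ≤ τc`, then the readout at `t + unit n · σT` lies in
`Tube (read n (u t)) σT`, and if `σT = τc` the readout has visited `Aout` at some
`t + unit n · σ`, `σ ∈ [0, τc]`: by `defect` the rescaled readout `σ ↦ read n (u (t + unit n · σ))`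
is a continuous curve in `U` with right derivative `ε`-close to `F`, which is the hypothesis of
`cert`. [folklore] -/
theorem cert_of_guard (n : ℕ) {t : ℝ} (ht : 0 ≤ t) (hin : R.read n (u t) ∈ R.Ain) {σT : ℝ}
    (hσT0 : 0 ≤ σT) (hσT : σT ≤ R.τc) (hS' : t + R.unit n * σT < S')
    (hG : ∀ x ∈ Ico t (t + R.unit n * σT), R.Guard n (u x)) :
    R.read n (u (t + R.unit n * σT)) ∈ R.Tube (R.read n (u t)) σT ∧
      (σT = R.τc → ∃ σ ∈ Icc 0 R.τc, R.read n (u (t + R.unit n * σ)) ∈ R.Aout) := by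
  have hun := R.unit_pos n
  have hphys : ∀ σ ∈ Ico 0 σT, t + R.unit n * σ ∈ Ico t (t + R.unit n * σT) := fun σ hσ =>
    ⟨le_add_of_nonneg_right (mul_nonneg hun.le hσ.1),
      add_lt_add_right (mul_lt_mul_of_pos_left hσ.2 hun) t⟩
  have hphys' : ∀ σ ∈ Ico 0 σT, 0 ≤ t + R.unit n * σ ∧ t + R.unit n * σ < S' := fun σ hσ =>
    ⟨ht.trans (hphys σ hσ).1, (hphys σ hσ).2.trans hS'⟩
  have hW : ∀ σ ∈ Ico 0 σT, ∃ W : O,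
      HasDerivWithinAt (fun t' => R.read n (u t')) W (Ici (t + R.unit n * σ)) (t + R.unit n * σ) ∧
        ‖R.unit n • W - R.F (R.read n (u (t + R.unit n * σ)))‖ ≤ R.ε := fun σ hσ =>
    R.defect n a S' u hu _ (hphys' σ hσ).1 (hphys' σ hσ).2 (hG _ (hphys σ hσ)).1
      (hG _ (hphys σ hσ)).2
  choose! W hW using hW
  have hcont : ContinuousOn (fun σ => R.read n (u (t + R.unit n * σ))) (Icc 0 σT) := by
    refine (R.read_continuousOn hu n).comp (by fun_prop) fun σ hσ => ⟨?_, ?_⟩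
    · exact add_nonneg ht (mul_nonneg hun.le hσ.1)
    · exact (add_le_add_right (mul_le_mul_of_nonneg_left hσ.2 hun.le) t).trans_lt hS'
  have hderiv : ∀ σ ∈ Ico 0 σT, HasDerivWithinAt (fun σ => R.read n (u (t + R.unit n * σ)))
      (R.unit n • W σ) (Ici σ) σ := by
    intro σ hσ
    have hh : HasDerivWithinAt (fun z : ℝ => t + R.unit n * z) (R.unit n) (Ici σ) σ := by
      simpa using ((hasDerivWithinAt_id σ (Ici σ)).const_mul (R.unit n)).const_add t
    exact (hW σ hσ).1.scomp σ hh fun z hz => add_le_add_right (mul_le_mul_of_nonneg_left hz hun.le) t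
  have h0 : (fun σ => R.read n (u (t + R.unit n * σ))) 0 = R.read n (u t) := by
    simp only [mul_zero, add_zero]
  exact R.cert (R.read n (u t)) hin σT (fun σ => R.read n (u (t + R.unit n * σ))) hσT0 hσT h0 hcont
    (fun σ hσ => (hG _ (hphys σ hσ)).1) (fun σ hσ => ⟨R.unit n • W σ, hderiv σ hσ, (hW σ hσ).2⟩)

/-- **GUARDED LEAKAGE** (a Dini-derivative fence, as in `LocalCircuit.junk_toReal_le_of_guard`):
with finite generation-`n` junk at time `t ≥ 0`, if the state stays in the working region for
physical times `[t, T)`, `T < S'`, then on `[t, T]` the junk grows at most linearly at rate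
`γ √E_n / unit n`. [folklore] -/
theorem junk_toReal_le_of_guard (n : ℕ) {t T : ℝ} (ht : 0 ≤ t) (hT : T < S')
    (hfin : R.junk n (u t) ≠ ⊤) (hG : ∀ x ∈ Ico t T, R.Guard n (u x)) :
    ∀ x ∈ Icc t T, (R.junk n (u x)).toReal ≤
      (R.junk n (u t)).toReal + R.γ * (Real.sqrt (S.Emin n) / R.unit n) * (x - t) := by
  intro x hx
  have htT : t ≤ T := hx.1.trans hx.2
  have hun := R.unit_pos n
  have hE : 0 < Real.sqrt (S.Emin n) := Real.sqrt_pos.2 (S.Emin_pos n)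
  set c : ℝ := Real.sqrt (S.Emin n) / R.unit n with hc
  have hc0 : 0 < c := div_pos hE hun
  have hI : Icc t T ⊆ Ico 0 S' := fun y hy => ⟨ht.trans hy.1, hy.2.trans_lt hT⟩
  set J : ℝ → ℝ := fun y => (R.junk n (u y)).toReal with hJ
  have hJc : ContinuousOn J (Icc t T) := fun y hy =>
    (R.junk_toReal_continuousWithinAt hu n (hI hy)
      (R.junk_ne_top hu n (hI ⟨le_rfl, htT⟩) hfin (hI hy))).mono hI
  have key : ∀ ρ, R.γ < ρ → J x ≤ J t + ρ * c * (x - t) := by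
    intro ρ hρ
    refine image_le_of_liminf_slope_right_lt_deriv_boundary' (f := J) (f' := fun _ => R.γ * c)
      (a := t) (b := T) hJc ?_ (B := fun y => J t + ρ * c * (y - t)) (B' := fun _ => ρ * c)
      (by simp) (by fun_prop) ?_ (fun _ _ _ => mul_lt_mul_of_pos_right hρ hc0) hx
    · intro y hy r hr
      obtain ⟨r', hr'1, hr'2⟩ := exists_between hr
      have hr'0 : 0 < r' := (mul_nonneg R.γ_nonneg hc0.le).trans_lt hr'1
      have hρ' : R.γ < r' / c := by rwa [lt_div_iff₀ hc0]
      have hy0 : 0 ≤ y := ht.trans hy.1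
      have hyS : y < S' := hy.2.trans hT
      have hfreq := R.junk_rate n a S' u hu y hy0 hyS (hG y hy).1 (hG y hy).2 (r' / c) hρ'
      have hev : ∀ᶠ z in 𝓝[>] y, y < z := eventually_nhdsWithin_of_forall fun z hz => hz
      refine (hfreq.and_eventually hev).mono fun z hz => ?_
      obtain ⟨hz, hyz⟩ := hz
      have hyfin : R.junk n (u y) ≠ ⊤ := (hG y hy).2.ne_top
      have hq : 0 ≤ r' / c * Real.sqrt (S.Emin n) * ((z - y) / R.unit n) :=
        mul_nonneg (mul_nonneg (div_nonneg hr'0.le hc0.le) hE.le)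
          (div_nonneg (sub_nonneg.2 hyz.le) hun.le)
      have hcc : r' / c * Real.sqrt (S.Emin n) * ((z - y) / R.unit n) = r' * (z - y) := by
        rw [hc]; field_simp
      have hJz : J z ≤ J y + r' * (z - y) := by
        have h1 := ENNReal.toReal_mono (ENNReal.add_ne_top.2 ⟨hyfin, ENNReal.ofReal_ne_top⟩) hz
        rw [ENNReal.toReal_add hyfin ENNReal.ofReal_ne_top, ENNReal.toReal_ofReal hq, hcc] at h1
        exact h1
      rw [slope_def_field]
      calc (J z - J y) / (z - y) ≤ r' := by rw [div_le_iff₀ (sub_pos.2 hyz)]; linarith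
        _ < r := hr'2
    · intro y _
      have h := (((hasDerivWithinAt_id y (Ici y)).sub_const t).const_mul (ρ * c)).const_add (J t)
      simpa using h
  have htend : Tendsto (fun ρ => J t + ρ * c * (x - t)) (𝓝[>] R.γ) (𝓝 (J t + R.γ * c * (x - t))) :=
    ((by fun_prop : Continuous fun ρ : ℝ => J t + ρ * c * (x - t)).tendsto R.γ).mono_left
      nhdsWithin_le_nhds
  exact ge_of_tendsto htend (eventually_nhdsWithin_of_forall fun ρ hρ => key ρ hρ)

end Trajectory

/-! ### §5. The bootstrap: reach tube and leakage over a whole cycle -/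

/-- **SHARP REACH AND LEAKAGE over a whole cycle** (the bootstrap). Along every `H¹⁰_df`-mild
Navier–Stokes trajectory LOADED at generation `n` at time `t ≥ 0` (`read n (u t) ∈ Ain`,
`junk n (u t) ≤ jin √E_n`), for every rescaled `σ ∈ [0, τc]` with `t + unit n · σ` inside the
lifespan: the readout is in the reach tube `Tube (read n (u t)) σ` AND the junk is at most
`(jin + γ σ) √E_n`. Proof: continuous induction on physical time over `[t, t + unit n · σ]` for the
set where both hold — it is closed (`Tube_closed`; readout and junk are continuous along the
trajectory), holds at `t` (`Tube_zero`), and from `[t, x]` it propagates past `x`: both conditions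
put the state in the working region on `[t, x]` (`guard_of_mem`), the working region is open so
the state stays in it a little longer (continuity), and on any such stretch `cert_of_guard` /
`junk_toReal_le_of_guard` re-establish both
(`IsClosed.Icc_subset_of_forall_mem_nhdsGT_of_Icc_subset`). [folklore] -/
theorem reach_sharp (n : ℕ) (a : L2C) (S' : ℝ) (u : ℝ → L2C)
    (hu : IsMildSolutionFor eulerForm a (Ico 0 S') u) (t : ℝ) (ht : 0 ≤ t)
    (hin : R.read n (u t) ∈ R.Ain)
    (hj : R.junk n (u t) ≤ ENNReal.ofReal (R.jin * Real.sqrt (S.Emin n)))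
    (σ : ℝ) (hσ0 : 0 ≤ σ) (hστ : σ ≤ R.τc) (hlt : t + R.unit n * σ < S') :
    R.read n (u (t + R.unit n * σ)) ∈ R.Tube (R.read n (u t)) σ ∧
      R.junk n (u (t + R.unit n * σ)) ≤
        ENNReal.ofReal ((R.jin + R.γ * σ) * Real.sqrt (S.Emin n)) := by
  have hun := R.unit_pos n
  have hE : 0 < Real.sqrt (S.Emin n) := Real.sqrt_pos.2 (S.Emin_pos n)
  set p : O := R.read n (u t) with hp
  set T₁ : ℝ := t + R.unit n * σ with hT₁
  have htT₁ : t ≤ T₁ := le_add_of_nonneg_right (mul_nonneg hun.le hσ0)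
  have hI : Icc t T₁ ⊆ Ico 0 S' := fun y hy => ⟨ht.trans hy.1, hy.2.trans_lt hlt⟩
  have htI : t ∈ Ico 0 S' := hI ⟨le_rfl, htT₁⟩
  -- rescaled time elapsed since `t`
  set τ : ℝ → ℝ := fun x => (x - t) / R.unit n with hτ
  have hτx : ∀ x, t + R.unit n * τ x = x := fun x => by
    simp only [hτ]; rw [mul_comm, div_mul_cancel₀ _ hun.ne']; ring
  have hτt : τ t = 0 := by simp [hτ]
  have hτT₁ : τ T₁ = σ := by
    simp only [hτ, hT₁, add_sub_cancel_left, mul_div_cancel_left₀ σ hun.ne']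
  have hτ_mono : ∀ x y, x ≤ y → τ x ≤ τ y := fun x y hxy =>
    div_le_div_of_nonneg_right (sub_le_sub_right hxy t) hun.le
  have hτ_le : ∀ x ∈ Icc t T₁, τ x ∈ Icc 0 R.τc := fun x hx =>
    ⟨div_nonneg (sub_nonneg.2 hx.1) hun.le, ((hτ_mono x T₁ hx.2).trans_eq hτT₁).trans hστ⟩
  have hτc : Continuous τ := by simp only [hτ]; fun_prop
  -- junk is finite along the trajectory; its real value
  have hfin : ∀ x ∈ Ico 0 S', R.junk n (u x) ≠ ⊤ := fun x hx =>
    R.junk_ne_top hu n htI (ne_top_of_le_ne_top ENNReal.ofReal_ne_top hj) hx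
  set J : ℝ → ℝ := fun x => (R.junk n (u x)).toReal with hJ
  have hJt : J t ≤ R.jin * Real.sqrt (S.Emin n) :=
    ENNReal.toReal_le_of_le_ofReal (mul_pos (R.jcore_nonneg.trans_lt R.jcore_lt) hE).le hj
  -- the bootstrap set
  set B : Set ℝ := {x | (τ x ∈ Icc 0 R.τc ∧ R.read n (u x) ∈ R.Tube p (τ x)) ∧
    J x ≤ R.jin * Real.sqrt (S.Emin n) + R.γ * Real.sqrt (S.Emin n) * τ x} with hB
  -- (i) members of `B` in the lifespan are in the working region
  have hguard : ∀ x ∈ Icc t T₁, x ∈ B → R.Guard n (u x) := by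
    intro x hx hxB
    refine R.guard_of_mem n hin hxB.1.1 hxB.1.2 ?_
    rw [← ENNReal.ofReal_toReal (hfin x (hI hx))]
    refine ENNReal.ofReal_le_ofReal ?_
    calc J x ≤ R.jin * Real.sqrt (S.Emin n) + R.γ * Real.sqrt (S.Emin n) * τ x := hxB.2
      _ = (R.jin + R.γ * τ x) * Real.sqrt (S.Emin n) := by ring
  -- (ii) `B ∩ [t, T₁]` is closed
  have hclosed : IsClosed (B ∩ Icc t T₁) := by
    have hread : ContinuousOn (fun x => R.read n (u x)) (Icc t T₁) :=
      (R.read_continuousOn hu n).mono hI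
    have hpair : ContinuousOn (fun x => (τ x, R.read n (u x))) (Icc t T₁) :=
      hτc.continuousOn.prodMk hread
    have h1 := hpair.preimage_isClosed_of_isClosed isClosed_Icc (R.Tube_closed p hin)
    have hJc : ContinuousOn J (Icc t T₁) := fun y hy =>
      (R.junk_toReal_continuousWithinAt hu n (hI hy) (hfin y (hI hy))).mono hI
    have hrhs : Continuous fun x => R.jin * Real.sqrt (S.Emin n) + R.γ * Real.sqrt (S.Emin n) * τ x := by
      fun_prop
    have h2 := hJc.prodMk hrhs.continuousOn |>.preimage_isClosed_of_isClosed isClosed_Icc isClosed_le_prod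
    have hEq : B ∩ Icc t T₁ =
        (Icc t T₁ ∩ (fun x => (τ x, R.read n (u x))) ⁻¹'
            {z : ℝ × O | z.1 ∈ Icc 0 R.τc ∧ z.2 ∈ R.Tube p z.1}) ∩
          (Icc t T₁ ∩ (fun x => (J x, R.jin * Real.sqrt (S.Emin n) + R.γ * Real.sqrt (S.Emin n) * τ x)) ⁻¹'
            {q : ℝ × ℝ | q.1 ≤ q.2}) := by
      ext x
      simp only [hB, mem_inter_iff, mem_setOf_eq, mem_preimage]
      tauto
    rw [hEq]
    exact h1.inter h2
  -- (iii) `t ∈ B`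
  have htB : t ∈ B := by
    refine ⟨⟨?_, ?_⟩, ?_⟩
    · rw [hτt]; exact ⟨le_rfl, R.τc_nonneg⟩
    · rw [hτt]; exact R.Tube_zero p hin
    · rw [hτt, mul_zero, add_zero]; exact hJt
  -- (iv) continuous induction
  have hmain : Icc t T₁ ⊆ B := by
    refine hclosed.Icc_subset_of_forall_mem_nhdsGT_of_Icc_subset htB fun x hx hxB => ?_
    have hxI : x ∈ Ico 0 S' := hI ⟨hx.1, hx.2.le⟩
    -- the working region on `[t, x]`
    have hG1 : ∀ y ∈ Icc t x, R.Guard n (u y) := fun y hy =>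
      hguard y ⟨hy.1, hy.2.trans hx.2.le⟩ (hxB hy)
    -- … and, by openness and continuity, on `[x, m)` for some `m ∈ (x, T₁]`
    obtain ⟨m, hxm, hmT, hG2⟩ : ∃ m, x < m ∧ m ≤ T₁ ∧ ∀ y ∈ Ico x m, R.Guard n (u y) := by
      have hGx := hG1 x ⟨hx.1, le_rfl⟩
      have h1 : ∀ᶠ y in 𝓝[Ico 0 S'] x, R.read n (u y) ∈ R.U :=
        Filter.Tendsto.eventually_mem ((R.read_continuousOn hu n) x hxI) (R.U_open.mem_nhds hGx.1)
      have h2 : ∀ᶠ y in 𝓝[Ico 0 S'] x,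
          R.junk n (u y) < ENNReal.ofReal (R.jbar * Real.sqrt (S.Emin n)) :=
        Filter.Tendsto.eventually_mem (R.junk_tendsto hu n hxI (hfin x hxI)) (Iio_mem_nhds hGx.2)
      obtain ⟨η, hη, hball⟩ := Metric.eventually_nhds_iff.1 (eventually_nhdsWithin_iff.1 (h1.and h2))
      refine ⟨min (x + η) T₁, lt_min (by linarith) hx.2, min_le_right _ _, fun y hy => ?_⟩
      have hy1 : y < x + η := (lt_min_iff.1 hy.2).1
      have hy2 : y < T₁ := (lt_min_iff.1 hy.2).2
      have hyx : dist y x < η := by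
        rw [Real.dist_eq, abs_of_nonneg (sub_nonneg.2 hy.1)]; linarith
      exact hball hyx ⟨(ht.trans hx.1).trans hy.1, hy2.trans hlt⟩
    -- so every `y ∈ (x, m)` is in `B`
    have hIoo : Ioo x m ⊆ B := by
      intro y hy
      have hyT : y ≤ T₁ := hy.2.le.trans hmT
      have hty : t ≤ y := hx.1.trans hy.1.le
      have hyS : y < S' := (hy.2.trans_le hmT).trans hlt
      have hGy : ∀ z ∈ Ico t y, R.Guard n (u z) := by
        intro z hz
        rcases le_or_gt z x with hzx | hxz
        · exact hG1 z ⟨hz.1, hzx⟩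
        · exact hG2 z ⟨hxz.le, hz.2.trans hy.2⟩
      have hτy : τ y ∈ Icc 0 R.τc := hτ_le y ⟨hty, hyT⟩
      refine ⟨⟨hτy, ?_⟩, ?_⟩
      · have hS'y : t + R.unit n * τ y < S' := by rw [hτx]; exact hyS
        have hGy' : ∀ z ∈ Ico t (t + R.unit n * τ y), R.Guard n (u z) := by rw [hτx]; exact hGy
        have h := (R.cert_of_guard hu n ht hin hτy.1 hτy.2 hS'y hGy').1
        rwa [hτx] at h
      · have h := R.junk_toReal_le_of_guard hu n ht hyS (hfin t htI) hGy y ⟨hty, le_rfl⟩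
        calc J y ≤ J t + R.γ * (Real.sqrt (S.Emin n) / R.unit n) * (y - t) := h
          _ = J t + R.γ * Real.sqrt (S.Emin n) * τ y := by simp only [hτ]; ring
          _ ≤ R.jin * Real.sqrt (S.Emin n) + R.γ * Real.sqrt (S.Emin n) * τ y :=
              add_le_add_left hJt _
    exact mem_of_superset (Ioo_mem_nhdsGT hxm) hIoo
  -- (v) read off at `T₁`
  have hT₁B := hmain ⟨htT₁, le_rfl⟩
  refine ⟨?_, ?_⟩
  · have h : R.read n (u T₁) ∈ R.Tube p (τ T₁) := hT₁B.1.2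
    rwa [hτT₁] at h
  · rw [← ENNReal.ofReal_toReal (hfin T₁ (hI ⟨htT₁, le_rfl⟩))]
    refine ENNReal.ofReal_le_ofReal ?_
    calc J T₁ ≤ R.jin * Real.sqrt (S.Emin n) + R.γ * Real.sqrt (S.Emin n) * τ T₁ := hT₁B.2
      _ = (R.jin + R.γ * σ) * Real.sqrt (S.Emin n) := by rw [hτT₁]; ring

/-- **LEAKAGE over a whole cycle**: junk below the running threshold `jrun √E_n`, unguarded, up to
lifespan. [cite: Tao2016AveragedNS, §1.3 pp. 10–11] -/
theorem leak (n : ℕ) (a : L2C) (S' : ℝ) (u : ℝ → L2C)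
    (hu : IsMildSolutionFor eulerForm a (Ico 0 S') u) (t : ℝ) (ht : 0 ≤ t)
    (hin : R.read n (u t) ∈ R.Ain)
    (hj : R.junk n (u t) ≤ ENNReal.ofReal (R.jin * Real.sqrt (S.Emin n)))
    (σ : ℝ) (hσ0 : 0 ≤ σ) (hστ : σ ≤ R.τc) (hlt : t + R.unit n * σ < S') :
    R.junk n (u (t + R.unit n * σ)) ≤ ENNReal.ofReal (R.jrun * Real.sqrt (S.Emin n)) :=
  (R.reach_sharp n a S' u hu t ht hin hj σ hσ0 hστ hlt).2.trans (ENNReal.ofReal_le_ofReal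
    (mul_le_mul_of_nonneg_right (R.jin_add_mul_le hστ) (Real.sqrt_nonneg _)))

/-- **A loaded trajectory stays in the working region for the whole cycle** (unguarded, up to
lifespan): every physical time in `[t, t + unit n · τc]` inside the lifespan. [folklore] -/
theorem guard_of_loaded (n : ℕ) (a : L2C) (S' : ℝ) (u : ℝ → L2C)
    (hu : IsMildSolutionFor eulerForm a (Ico 0 S') u) (t : ℝ) (ht : 0 ≤ t) (hin : u t ∈ R.In n)
    {y : ℝ} (hty : t ≤ y) (hyT : y ≤ t + R.unit n * R.τc) (hyS : y < S') : R.Guard n (u y) := by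
  have hun := R.unit_pos n
  obtain ⟨σ, hσ0, hστ, rfl⟩ : ∃ σ, 0 ≤ σ ∧ σ ≤ R.τc ∧ t + R.unit n * σ = y := by
    refine ⟨(y - t) / R.unit n, div_nonneg (sub_nonneg.2 hty) hun.le, ?_, ?_⟩
    · rw [div_le_iff₀ hun]; linarith [mul_comm (R.unit n) R.τc]
    · rw [mul_div_cancel₀ _ hun.ne']; ring
  have h := R.reach_sharp n a S' u hu t ht hin.1 hin.2 σ hσ0 hστ hyS
  exact R.guard_of_mem n hin.1 ⟨hσ0, hστ⟩ h.1 h.2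

/-- **REALISATION (`PumpGadget.fires`) is a theorem of the design**: every mild Navier–Stokes
trajectory loaded at generation `n` at time `t ≥ 0` and alive past `t + unit n · τc` passes
through the generation-`n` output class within that time — the state stays in the working region
for the whole cycle (`guard_of_loaded`), so the certificate's REACH clause (`cert_of_guard` with
`σT = τc`) gives a rescaled time `σ ≤ τc` at which the readout is in `Aout`; `leak` bounds the
junk there and `handoff` reads the result as a loaded core of generation `n+1`. Early firing is
harmless. [cite: Tao2016AveragedNS, §1.3 pp. 10–11] -/
theorem fires (n : ℕ) (a : L2C) (S' : ℝ) (u : ℝ → L2C)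
    (hu : IsMildSolutionFor eulerForm a (Ico 0 S') u) (t : ℝ) (ht : 0 ≤ t) (hin : u t ∈ R.In n)
    (hT : t + R.unit n * R.τc < S') :
    ∃ r : ℝ, t ≤ r ∧ r ≤ t + R.unit n * R.τc ∧ u r ∈ R.Out n := by
  have hun := R.unit_pos n
  have hG : ∀ x ∈ Ico t (t + R.unit n * R.τc), R.Guard n (u x) := fun x hx =>
    R.guard_of_loaded n a S' u hu t ht hin hx.1 hx.2.le (hx.2.trans hT)
  obtain ⟨σ, hσ, hout⟩ := (R.cert_of_guard hu n ht hin.1 R.τc_nonneg le_rfl hT hG).2 rfl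
  have hle : t + R.unit n * σ ≤ t + R.unit n * R.τc :=
    add_le_add_right (mul_le_mul_of_nonneg_left hσ.2 hun.le) t
  have hlt : t + R.unit n * σ < S' := hle.trans_lt hT
  have hlk := R.leak n a S' u hu t ht hin.1 hin.2 σ hσ.1 hσ.2 hlt
  exact ⟨t + R.unit n * σ, le_add_of_nonneg_right (mul_nonneg hun.le hσ.1), hle,
    R.handoff n _ hout hlk⟩

/-! ### §6. The pump cascade of the design; noise tolerance with an explicit radius -/

/-- **The generation-`n` pump gadget of the design**: scale `λ_n`, classes `In n` / `Out n`, floor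
`E_n` (`floor_cert`), tick `unit n · τc`, realisation by `ReachCircuit.fires`. [cite: Tao2016AveragedNS, §1.3 pp. 10–11] -/
def gadget (n : ℕ) : PumpGadget where
  κ := S.lam n
  κ_nonneg := (S.lam_pos n).le
  In := R.In n
  Out := R.Out n
  Ein := S.Emin n
  in_floor := fun v hv => R.floor_cert n v hv.1 hv.2
  T := R.unit n * R.τc
  T_nonneg := mul_nonneg (R.unit_pos n).le R.τc_nonneg
  fires := R.fires n

/-- The gadget's input class is the design's. [folklore] -/
@[simp] theorem gadget_In (n : ℕ) : (R.gadget n).In = R.In n := rfl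
/-- The gadget's output class is the design's. [folklore] -/
@[simp] theorem gadget_Out (n : ℕ) : (R.gadget n).Out = R.Out n := rfl
/-- The gadget's tick is `unit n · τc`. [folklore] -/
@[simp] theorem gadget_T (n : ℕ) : (R.gadget n).T = R.unit n * R.τc := rfl
/-- The gadget's scale is `λ_n`. [folklore] -/
@[simp] theorem gadget_κ (n : ℕ) : (R.gadget n).κ = S.lam n := rfl
/-- The gadget's floor is `E_n`. [folklore] -/
@[simp] theorem gadget_Ein (n : ℕ) : (R.gadget n).Ein = S.Emin n := rfl

/-- **The pump cascade of the design** (`PumpCascade S`): realisation, self-replication, floors,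
clock and ignition are theorems of the design's fields. Downstream (`PumpCascade.lifespan_le`):
finite lifespan `≤ T_*` of every mild trajectory from the seed when `α > 0`, `η > 1/4`. [cite: Tao2016AveragedNS, §1.3 pp. 10–11] -/
def toPumpCascade : PumpCascade S where
  G := R.gadget
  scale := fun _ => rfl
  replicate := R.Out_subset_In
  energy := fun _ => le_rfl
  time := R.clock
  u₀ := R.u₀
  divFree := R.divFree
  memH10df := R.memH10df
  ignite := R.seed_mem_In

/-- The cascade's gadgets are the design's. [folklore] -/
@[simp] theorem toPumpCascade_G (n : ℕ) : R.toPumpCascade.G n = R.gadget n := rfl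
/-- The cascade's ignition datum is the design's seed. [folklore] -/
@[simp] theorem toPumpCascade_u₀ : R.toPumpCascade.u₀ = R.u₀ := rfl

/-- The design's **relative noise tolerance** `ρ = min (δ/Λ) (jin − jcore)`. [folklore] -/
def rho : ℝ := min (R.δ / R.Λ) (R.jin - R.jcore)

/-- The tolerance is positive (`δ, Λ > 0`, `jcore < jin`). [folklore] -/
theorem rho_pos : 0 < R.rho :=
  lt_min (div_pos R.δ_pos R.Λ_pos) (sub_pos.2 R.jcore_lt)

/-- `ρ ≤ δ/Λ`. [folklore] -/
theorem rho_le_div : R.rho ≤ R.δ / R.Λ := min_le_left _ _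

/-- `ρ ≤ jin − jcore`. [folklore] -/
theorem rho_le_sub : R.rho ≤ R.jin - R.jcore := min_le_right _ _

/-- **The tolerance lemma**: for `s ≥ 0`, every state within `ρ √E_n` in `X^s_{λ_n}` of a state read
in the core at generation `n` with core junk is a generation-`n` input state. [folklore] -/
theorem mem_In_of_near (hs : 0 ≤ s) (n : ℕ) {v w : L2C} (hr : R.read n v ∈ R.Acore)
    (hj : R.junk n v ≤ ENNReal.ofReal (R.jcore * Real.sqrt (S.Emin n)))
    (hw : scaledSobolevNorm s (S.lam n) (w - v) < ENNReal.ofReal (R.rho * Real.sqrt (S.Emin n))) :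
    w ∈ R.In n := by
  have hE : 0 < Real.sqrt (S.Emin n) := Real.sqrt_pos.2 (S.Emin_pos n)
  refine ⟨?_, ?_⟩
  · have hL2 : ‖w - v‖ < R.rho * Real.sqrt (S.Emin n) := by
      have h := (enorm_le_scaledSobolevNorm hs (S.lam n) (w - v)).trans_lt hw
      rw [← ofReal_norm] at h
      exact (ENNReal.ofReal_lt_ofReal_iff_of_nonneg (norm_nonneg _)).1 h
    have hρΛ : R.Λ * R.rho ≤ R.δ := by
      have := mul_le_mul_of_nonneg_left R.rho_le_div R.Λ_pos.le
      rwa [mul_div_cancel₀ _ R.Λ_pos.ne'] at this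
    have hdist : dist (R.read n w) (R.read n v) < R.δ := by
      refine lt_of_mul_lt_mul_right ?_ hE.le
      calc dist (R.read n w) (R.read n v) * Real.sqrt (S.Emin n)
          ≤ R.Λ * ‖w - v‖ := R.read_lip n w v
        _ < R.Λ * (R.rho * Real.sqrt (S.Emin n)) := mul_lt_mul_of_pos_left hL2 R.Λ_pos
        _ = R.Λ * R.rho * Real.sqrt (S.Emin n) := by ring
        _ ≤ R.δ * Real.sqrt (S.Emin n) := mul_le_mul_of_nonneg_right hρΛ hE.le
    exact R.core_thick _ hr (Metric.mem_ball.2 hdist)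
  · calc R.junk n w ≤ R.junk n v + scaledSobolevNorm s (S.lam n) (w - v) := R.junk_perturb n v w
      _ ≤ ENNReal.ofReal (R.jcore * Real.sqrt (S.Emin n)) +
            ENNReal.ofReal (R.rho * Real.sqrt (S.Emin n)) := add_le_add hj hw.le
      _ = ENNReal.ofReal ((R.jcore + R.rho) * Real.sqrt (S.Emin n)) := by
          rw [add_mul, ENNReal.ofReal_add (mul_nonneg R.jcore_nonneg hE.le)
            (mul_nonneg R.rho_pos.le hE.le)]
      _ ≤ ENNReal.ofReal (R.jin * Real.sqrt (S.Emin n)) := by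
          refine ENNReal.ofReal_le_ofReal (mul_le_mul_of_nonneg_right ?_ hE.le)
          linarith [R.rho_le_sub]

/-- **NOISE TOLERANCE is a theorem of the design**: for `s ≥ 0` the design's cascade is `ρ`-robust
in `X^s` with `ρ = min (δ/Λ) (jin − jcore) > 0`. Downstream: STABLE clocked blow-up. [cite: Tao2016AveragedNS, §1.3 pp. 10–11] -/
def toRobustPumpCascade (hs : 0 ≤ s) : RobustPumpCascade S s R.rho where
  toPumpCascade := R.toPumpCascade
  margin := fun n _ hv _ _ hw => R.mem_In_of_near hs (n + 1) hv.1 hv.2 hw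
  igniteBall := fun _ _ hw => R.mem_In_of_near hs 0 R.seed_read R.seed_junk hw

/-- The robust cascade's underlying cascade is the design's. [folklore] -/
@[simp] theorem toRobustPumpCascade_toPumpCascade (hs : 0 ≤ s) :
    (R.toRobustPumpCascade hs).toPumpCascade = R.toPumpCascade := rfl

/-! ### §7. LIVENESS given `H¹⁰` control of the reach tube -/

/-- **`H¹⁰` control of the reach tube** (static, design-level; the one extra hypothesis of
liveness): at each generation `n` a bound `M_n` on the `H¹⁰` norm of every `H¹⁰_df` state whose
readout is in the reach tube `Tube p σ` of some `p ∈ Ain`, `σ ∈ [0, τc]`, and whose generation-`n`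
junk is below the running threshold. [folklore] -/
def H10Control : Prop :=
  ∀ n : ℕ, ∃ M : ℝ, ∀ v : L2C, MemH10df v →
    (∃ p ∈ R.Ain, ∃ σ ∈ Icc 0 R.τc, R.read n v ∈ R.Tube p σ) →
      R.junk n v ≤ ENNReal.ofReal (R.jrun * Real.sqrt (S.Emin n)) →
        eFourierSobolevNorm 10 v ≤ ENNReal.ofReal M

/-- **LIVENESS (`PumpCascade.Live`) is a theorem of the design** given the `H¹⁰` mild theory and
`H10Control`: otherwise a loaded state all of whose trajectories die within the tick has a maximal
trajectory with unbounded `H¹⁰` norm (`exists_maximal_unbounded_of_lifespan_le`), which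
`reach_sharp` keeps in the reach tube with running junk, an `H¹⁰`-bounded set — contradiction. [cite: Tao2016AveragedNS, §6 Prop. 6.3] -/
theorem live (hth : H10MildTheory) (hctrl : R.H10Control) : R.toPumpCascade.Live := by
  intro n v hv h10
  by_contra hne
  push Not at hne
  have hle : ∀ (S' : ℝ) (u : ℝ → L2C), IsMildSolutionFor eulerForm v (Ico 0 S') u →
      S' ≤ R.unit n * R.τc := by
    intro S' u hu
    by_contra h
    exact hne S' (lt_of_not_ge h) u hu
  obtain ⟨M, hM⟩ := hctrl n
  obtain ⟨Sm, hSm, hSmT, U, hU, -, hunb⟩ := exists_maximal_unbounded_of_lifespan_le hth h10 hle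
  obtain ⟨t', ht', hlt⟩ := hunb M
  have h0 : U 0 = v := initial_eq hU ⟨le_rfl, hSm⟩ h10
  have hv' : U 0 ∈ R.In n := by rw [h0]; exact hv
  have hne0 : R.unit n ≠ 0 := (R.unit_pos n).ne'
  set σ : ℝ := t' / R.unit n with hσdef
  have hσ0 : 0 ≤ σ := div_nonneg ht'.1 (R.unit_pos n).le
  have hσeq : R.unit n * σ = t' := by rw [mul_comm]; exact div_mul_cancel₀ t' hne0
  have hστ : σ ≤ R.τc := by
    have h1 : R.unit n * σ ≤ R.unit n * R.τc := by rw [hσeq]; exact ht'.2.le.trans hSmT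
    exact le_of_mul_le_mul_left h1 (R.unit_pos n)
  have hlt' : 0 + R.unit n * σ < Sm := by rw [zero_add, hσeq]; exact ht'.2
  have h := R.reach_sharp n v Sm U hU 0 le_rfl hv'.1 hv'.2 σ hσ0 hστ hlt'
  rw [zero_add, hσeq] at h
  have hbd := hM (U t') (hU.1 t' ht') ⟨R.read n (U 0), hv'.1, σ, ⟨hσ0, hστ⟩, h.1⟩
    (h.2.trans (ENNReal.ofReal_le_ofReal
      (mul_le_mul_of_nonneg_right (R.jin_add_mul_le hστ) (Real.sqrt_nonneg _))))
  exact absurd hlt (not_lt.2 hbd)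

/-- Hence **no loaded state of the design is doomed within its tick** (given the mild theory and
`H10Control`). [folklore] -/
theorem not_doomed_of_mem_In (hth : H10MildTheory) (hctrl : R.H10Control) (n : ℕ) {v : L2C}
    (hv : v ∈ R.In n) (h10 : MemH10df v) : ¬ Doomed (R.unit n * R.τc) v :=
  (R.live hth hctrl).not_doomed n hv h10

/-- Under liveness, every generation of the design is reached from the seed by a chain of mild
segments through loaded `H¹⁰_df` states carrying the spec's high-frequency energy. [cite: Tao2016AveragedNS, §1.3 pp. 10–11] -/
theorem exists_loaded (hth : H10MildTheory) (hctrl : R.H10Control) (n : ℕ) :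
    ∃ v ∈ R.In n, MemH10df v ∧ ENNReal.ofReal (S.Emin n) ≤ highFreqEnergy (S.lam n) v :=
  (R.live hth hctrl).exists_loaded n

end ReachCircuit

/-! ### §8. The local (Grönwall) design IS a reach design -/

namespace LocalCircuit

variable {S : CascadeSpecs} {O : Type*} [NormedAddCommGroup O] [NormedSpace ℝ O] {s : ℝ}
  (A : LocalCircuit S O s)

/-- **Grönwall's inequality as a reach certificate.** In a local design, every continuous curve on
`[0, σT]`, `σT ≤ τc`, from `p ∈ Ain`, in `U` on `[0, σT)` with right derivative `ε`-close to `F`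
there, is within `gronwallBound 0 L ε σ` of the circuit orbit `Φ σ p` for every `σ ≤ σT`
(`dist_le_of_approx_trajectories_ODE_of_mem`; the orbit is an exact trajectory inside `U` by
`tube`). [folklore] -/
theorem dist_le_gronwallBound_of_pseudo {p : O} (hp : p ∈ A.Ain) {σT : ℝ} (hσT : σT ≤ A.τc)
    {x : ℝ → O} (hx0 : x 0 = p) (hcont : ContinuousOn x (Icc 0 σT))
    (hU : ∀ σ ∈ Ico 0 σT, x σ ∈ A.U)
    (hW : ∀ σ ∈ Ico 0 σT, ∃ W : O, HasDerivWithinAt x W (Ici σ) σ ∧ ‖W - A.F (x σ)‖ ≤ A.ε) :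
    ∀ σ ∈ Icc 0 σT, dist (x σ) (A.Φ σ p) ≤ gronwallBound 0 (A.L : ℝ) A.ε σ := by
  choose! W hW using hW
  have key := dist_le_of_approx_trajectories_ODE_of_mem
    (v := fun _ => A.F) (s := fun _ => A.U) (K := A.L)
    (f := x) (f' := W) (g := fun σ => A.Φ σ p) (g' := fun σ => A.F (A.Φ σ p))
    (a := 0) (b := σT) (εf := A.ε) (εg := 0) (δ := 0)
    (fun _ _ => A.F_lip) hcont (fun σ hσ => (hW σ hσ).1)
    (fun σ hσ => by rw [dist_eq_norm]; exact (hW σ hσ).2)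
    hU
    ((A.flow_cont _ hp).mono (Icc_subset_Icc_right hσT))
    (fun σ hσ => A.flow_deriv _ hp σ ⟨hσ.1, hσ.2.trans_le hσT⟩)
    (fun σ _ => (dist_self _).le)
    (fun σ hσ => A.tube _ hp σ ⟨hσ.1, hσ.2.le.trans hσT⟩ (Metric.mem_closedBall_self A.δsh_nonneg))
    (by simp only [hx0, A.flow_zero _ hp, dist_self, le_refl])
  intro σ hσ
  simpa only [add_zero, sub_zero] using key σ hσ

/-- **The reach design of a local design**: all fields verbatim, the reach tube
`Tube p σ := closedBall (Φ σ p) (gronwallBound 0 L ε σ)` (closed graph by `flow_cont`; `Tube_zero`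
by `flow_zero`; inside `U` by `gronwallBound ≤ δsh` and `tube`), and the certificate DISCHARGED by
Grönwall's inequality for approximate trajectories (`dist_le_gronwallBound_of_pseudo`) and `dat`.
So the local layer is the special case of the reach layer whose certificate is Grönwall's — and
whose defect budget is therefore exponentially small in `L τc`. [cite: Tao2016AveragedNS, §1.3 pp. 10–11] -/
def toReachCircuit : ReachCircuit S O s where
  read := A.read
  recon := A.recon
  junk := A.junk
  Λ := A.Λ
  Λ_pos := A.Λ_pos
  read_lip := A.read_lip
  junk_perturb := A.junk_perturb
  s_le_ten := A.s_le_ten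
  read_recon := A.read_recon
  junk_recon := A.junk_recon
  Ain := A.Ain
  Acore := A.Acore
  Aout := A.Aout
  δ := A.δ
  δ_pos := A.δ_pos
  core_thick := A.core_thick
  jcore := A.jcore
  jin := A.jin
  jrun := A.jrun
  jbar := A.jbar
  jcore_nonneg := A.jcore_nonneg
  jcore_lt := A.jcore_lt
  jrun_lt_jbar := A.jrun_lt_jbar
  handoff := A.handoff
  floor_cert := A.floor_cert
  F := A.F
  U := A.U
  U_open := A.U_open
  τc := A.τc
  τc_nonneg := A.τc_nonneg
  ε := A.ε
  ε_nonneg := A.ε_nonneg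
  Tube := fun p σ => Metric.closedBall (A.Φ σ p) (gronwallBound 0 (A.L : ℝ) A.ε σ)
  Tube_closed := by
    intro p hp
    show IsClosed {z : ℝ × O | z.1 ∈ Icc 0 A.τc ∧
      z.2 ∈ Metric.closedBall (A.Φ z.1 p) (gronwallBound 0 (A.L : ℝ) A.ε z.1)}
    have hf : ContinuousOn (fun z : ℝ × O => (dist z.2 (A.Φ z.1 p), gronwallBound 0 (A.L : ℝ) A.ε z.1))
        (Icc 0 A.τc ×ˢ univ) := by
      refine ContinuousOn.prodMk ?_ ?_
      · exact continuous_dist.comp_continuousOn (continuous_snd.continuousOn.prodMk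
          ((A.flow_cont p hp).comp continuous_fst.continuousOn fun z hz => (mem_prod.1 hz).1))
      · exact ((continuous_iff_continuousAt.2 fun y =>
          (hasDerivAt_gronwallBound 0 (A.L : ℝ) A.ε y).continuousAt).comp continuous_fst).continuousOn
    have h := hf.preimage_isClosed_of_isClosed (isClosed_Icc.prod isClosed_univ) isClosed_le_prod
    have hEq : {z : ℝ × O | z.1 ∈ Icc 0 A.τc ∧
        z.2 ∈ Metric.closedBall (A.Φ z.1 p) (gronwallBound 0 (A.L : ℝ) A.ε z.1)} =
        Icc 0 A.τc ×ˢ univ ∩ (fun z : ℝ × O =>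
          (dist z.2 (A.Φ z.1 p), gronwallBound 0 (A.L : ℝ) A.ε z.1)) ⁻¹' {q : ℝ × ℝ | q.1 ≤ q.2} := by
      ext z
      simp only [mem_setOf_eq, mem_inter_iff, mem_prod, mem_univ, and_true, mem_preimage,
        Metric.mem_closedBall]
    rw [hEq]
    exact h
  Tube_zero := fun p hp => by
    show p ∈ Metric.closedBall (A.Φ 0 p) (gronwallBound 0 (A.L : ℝ) A.ε 0)
    rw [Metric.mem_closedBall, A.flow_zero p hp, gronwallBound_x0, dist_self]
  Tube_sub := fun p hp σ hσ =>
    (Metric.closedBall_subset_closedBall (A.gronwallBound_le_δsh hσ.2)).trans (A.tube p hp σ hσ)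
  cert := by
    intro p hp σT x hσT0 hσT hx0 hcont hU hW
    have h := A.dist_le_gronwallBound_of_pseudo hp hσT hx0 hcont hU hW
    refine ⟨Metric.mem_closedBall.2 (h σT ⟨hσT0, le_rfl⟩), fun hστ => ?_⟩
    obtain ⟨σ, hσ0, hσ, hball⟩ := A.dat p hp
    exact ⟨σ, ⟨hσ0, hσ⟩, hball (Metric.mem_closedBall.2
      ((h σ ⟨hσ0, hσ.trans_eq hστ.symm⟩).trans (A.gronwallBound_le_δsh hσ)))⟩
  γ := A.γ
  γ_nonneg := A.γ_nonneg
  jrun_ge := A.jrun_ge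
  unit := A.unit
  unit_pos := A.unit_pos
  clock := A.clock
  defect := A.defect
  junk_rate := A.junk_rate
  u₀ := A.u₀
  divFree := A.divFree
  memH10df := A.memH10df
  seed_read := A.seed_read
  seed_junk := A.seed_junk

/-- The reach design reads as the local design. [folklore] -/
@[simp] theorem toReachCircuit_read : A.toReachCircuit.read = A.read := rfl
/-- The reach design's junk is the local design's. [folklore] -/
@[simp] theorem toReachCircuit_junk : A.toReachCircuit.junk = A.junk := rfl
/-- The reach design's input region is the local design's. [folklore] -/
@[simp] theorem toReachCircuit_Ain : A.toReachCircuit.Ain = A.Ain := rfl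
/-- The reach design's cycle time is the local design's. [folklore] -/
@[simp] theorem toReachCircuit_τc : A.toReachCircuit.τc = A.τc := rfl
/-- The reach design's clock is the local design's. [folklore] -/
@[simp] theorem toReachCircuit_unit : A.toReachCircuit.unit = A.unit := rfl
/-- The reach design's defect level is the local design's. [folklore] -/
@[simp] theorem toReachCircuit_ε : A.toReachCircuit.ε = A.ε := rfl
/-- The reach tube of a local design is the Grönwall ball about the circuit orbit. [folklore] -/
theorem toReachCircuit_Tube (p : O) (σ : ℝ) :
    A.toReachCircuit.Tube p σ = Metric.closedBall (A.Φ σ p) (gronwallBound 0 (A.L : ℝ) A.ε σ) := rfl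
/-- The reach design's input classes are the local design's (as a shadowed circuit). [folklore] -/
theorem toReachCircuit_In (n : ℕ) : A.toReachCircuit.In n = A.toShadowedCircuit.In n := rfl
/-- The reach design's output classes are the local design's. [folklore] -/
theorem toReachCircuit_Out (n : ℕ) : A.toReachCircuit.Out n = A.toShadowedCircuit.Out n := rfl

end LocalCircuit

end Literature.Analysis.FluidPDE.FluidComputer

end
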